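/-
Copyright: width seat `ym-line-sll-p2` (prover-ym-line-sll-p2-g2-0), route `SoftLoopLongLag`, crux T′ `ColdBoxSoftLoopLagFloor`
(stmt-QuantumFields-22503 → rev 3 stmt-QuantumFields-24180), line `birth`, E-architecture brick E1a (inner flat lag floor), part 1.
-/
import Summits.QuantumFields.YangMills.Theorems.WeakCouplingRatesColdBoxGaussMoments
import Summits.QuantumFields.YangMills.Theorems.WeakCouplingRatesColdBoxDirichletShiftedCov
import Summits.QuantumFields.YangMills.Theorems.WeakCouplingRatesColdBoxDirichletDensity

/-!
# Route `SoftLoopLongLag`, crux T′ `ColdBoxSoftLoopLagFloor`, line `birth`, brick E1a-1 «SurfaceGauss»: SURFACE SUMS of the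
# temporal-gauge Dirichlet circulations — a centred Gaussian process indexed by finite plaquette sets, its kernel, variances,
# even moments and the Wick identity for squares (G-free, β-free)

The one-scale engine of the sibling route `ColdBoxAllGroups` (crux `BoxFloorAllGroups`, proved) linearises the cold-wall box
`boxState ρ β H` in the temporal-forest gauge and the exponential chart; its Gaussian reference is `D` colour copies of the Dirichlet
lattice Maxwell Gaussian `boxDirichlet H` (D1') whose one-plaquette circulations `dirCirc H p` form a centred Gaussian process with
two-point function `boxDirProjKernel H p q`.  For the soft LOOP observable of this route (an `R×R` Wilson loop, abelianised by lattice
Stokes) the Gaussian object is the **surface sum** (flux through the spanning surface)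
`X_A(s) = Σ_{p ∈ A} dirCirc H p s` over a finite set `A` of plaquettes of `ℤ⁴` (for the loop at `x`: `A = rectSurface x R R`).
This file is the loop counterpart of the one-plaquette inputs `integral_dirCirc_pow_even_le` / `integral_dirCirc_sq_mul_sq_sub`:

* `isGaussianProcess_surfSum` — `A ↦ X_A` is a Gaussian process under `boxDirichlet H` (a finite linear image of `dirCirc H`,
  Mathlib `IsGaussianProcess.of_isGaussianProcess`); `integral_surfSum` — centred;
* `integral_surfSum_mul_surfSum` — `E_D[X_A X_B] = Σ_{p∈A} Σ_{q∈B} boxDirProjKernel H p q` (the Dirichlet mutual inductance of the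
  two surfaces); `abs_boxDirProjKernel_le_one`, `integral_surfSum_sq_le` — `|K(p,q)| ≤ 1`, hence `E_D[X_A²] ≤ (#A)²`;
* `integral_surfSum_pow_even_le` — `E_D[X_A^{2r}] ≤ (2r−1)!!·(#A)^{4r}` … stated as `((#A)²)^r·(2r−1)!!` (Janson Rem. 1.30);
* `integral_surfSum_sq_mul_sq_sub` — Wick/Isserlis: `E_D[X_A²X_B²] − E_D[X_A²]E_D[X_B²] = 2·E_D[X_AX_B]²`;
* `memLp_two_half_surfSum_sq` — `½X_A² ∈ L²`.

Plaquettes are `ZdPlaquette 4` (as in `rectSurface`), read in `Plaq 4` through `(p.1, p.2.1.1, p.2.1.2)` (as in the sibling files).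
No sorry; no new definition; standard axioms.  HONEST LABEL: rung R2xi-G RECORD label (leaf `WeakCouplingRates.XiPow`, an UPPER bound on
the lattice mass gap); NOT the Clay mass gap; no summit statement is touched.

References: S. Janson, *Gaussian Hilbert Spaces* (1997) Thm 1.28, Rem. 1.29–1.30; S. Chatterjee, arXiv:1602.01222 §13 (finite-volume
lattice Maxwell Gaussians); C. Garban, A. Sepúlveda, IMRN 2023 §2.3.3.
-/

set_option autoImplicit false

noncomputable section

open MeasureTheory ProbabilityTheory Finset
open scoped Nat NNReal
open Literature.MathematicalPhysics.QuantumLattice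
open Literature.MathematicalPhysics.QuantumFieldTheory
open Literature.MathematicalPhysics.QuantumFieldTheory.LatticeMaxwell
open Literature.MathematicalPhysics.QuantumFieldTheory.AxialGauge

open Summit.QuantumFields.YangMills.Theorems.WeakCouplingRates

namespace Summit.QuantumFields.YangMills.Theorems.SoftLoopLongLag

variable {H : ℕ}

/-! ## The surface-sum process -/

/-- **The surface sums form a Gaussian process**: `A ↦ X_A = Σ_{p∈A} dirCirc H p` (finite plaquette sets `A ⊆ ℤ⁴`-plaquettes) is a
Gaussian process under `boxDirichlet H` — every `X_A` is a finite linear combination of the Gaussian process `dirCirc H`. -/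
theorem isGaussianProcess_surfSum (H : ℕ) :
    IsGaussianProcess (fun (A : Finset (ZdPlaquette 4)) (s : EuclideanSpace ℝ (DirFree H)) =>
      ∑ p ∈ A, dirCirc H (p.1, p.2.1.1, p.2.1.2) s) (boxDirichlet H) := by
  classical
  refine (isGaussianProcess_dirCirc H).of_isGaussianProcess fun A => ?_
  refine ⟨A.image fun p : ZdPlaquette 4 => ((p.1, p.2.1.1, p.2.1.2) : Plaq 4),
    ∑ p ∈ A.attach, ContinuousLinearMap.proj (R := ℝ)
      (⟨(p.1.1, p.1.2.1.1, p.1.2.1.2), Finset.mem_image_of_mem _ p.2⟩ :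
        ↥(A.image fun p : ZdPlaquette 4 => ((p.1, p.2.1.1, p.2.1.2) : Plaq 4))), fun s => ?_⟩
  simp only [FunLike.coe_sum, Finset.sum_apply, ContinuousLinearMap.proj_apply, Finset.restrict_def]
  exact (Finset.sum_attach A fun p => dirCirc H (p.1, p.2.1.1, p.2.1.2) s).symm

/-- A surface sum is measurable. -/
theorem measurable_surfSum (A : Finset (ZdPlaquette 4)) :
    Measurable fun s : EuclideanSpace ℝ (DirFree H) => ∑ p ∈ A, dirCirc H (p.1, p.2.1.1, p.2.1.2) s :=
  Finset.measurable_sum _ fun _ _ => measurable_dirCirc _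

/-- A surface sum is integrable. -/
theorem integrable_surfSum (A : Finset (ZdPlaquette 4)) :
    Integrable (fun s : EuclideanSpace ℝ (DirFree H) => ∑ p ∈ A, dirCirc H (p.1, p.2.1.1, p.2.1.2) s) (boxDirichlet H) :=
  integrable_finsetSum _ fun p _ => by
    have h := integrable_dirCirc_prod (H := H) (Finset.univ : Finset (Fin 1)) (fun _ => ((p.1, p.2.1.1, p.2.1.2) : Plaq 4))
    simpa using h

/-- **The surface sums are centred**: `E_D[X_A] = 0`. -/
theorem integral_surfSum (A : Finset (ZdPlaquette 4)) :
    ∫ s, ∑ p ∈ A, dirCirc H (p.1, p.2.1.1, p.2.1.2) s ∂(boxDirichlet H) = 0 := by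
  rw [integral_finsetSum _ fun p _ => ?_]
  · exact Finset.sum_eq_zero fun p _ => integral_dirCirc _
  · have h := integrable_dirCirc_prod (H := H) (Finset.univ : Finset (Fin 1)) (fun _ => ((p.1, p.2.1.1, p.2.1.2) : Plaq 4))
    simpa using h

/-- Products of two circulations are integrable. -/
theorem integrable_dirCirc_mul_dirCirc (p q : Plaq 4) :
    Integrable (fun s : EuclideanSpace ℝ (DirFree H) => dirCirc H p s * dirCirc H q s) (boxDirichlet H) := by
  have h := integrable_dirCirc_prod (H := H) (Finset.univ : Finset (Fin 2)) ![p, q]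
  simpa [Fin.prod_univ_two] using h

/-- **Two-point function of surface sums = Dirichlet mutual inductance of the surfaces**:
`E_D[X_A X_B] = Σ_{p∈A} Σ_{q∈B} boxDirProjKernel H p q`. -/
theorem integral_surfSum_mul_surfSum (A B : Finset (ZdPlaquette 4)) :
    ∫ s, (∑ p ∈ A, dirCirc H (p.1, p.2.1.1, p.2.1.2) s) * (∑ q ∈ B, dirCirc H (q.1, q.2.1.1, q.2.1.2) s) ∂(boxDirichlet H) =
      ∑ p ∈ A, ∑ q ∈ B, boxDirProjKernel H (p.1, p.2.1.1, p.2.1.2) (q.1, q.2.1.1, q.2.1.2) := by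
  have hexp : ∀ s : EuclideanSpace ℝ (DirFree H),
      (∑ p ∈ A, dirCirc H (p.1, p.2.1.1, p.2.1.2) s) * (∑ q ∈ B, dirCirc H (q.1, q.2.1.1, q.2.1.2) s) =
        ∑ p ∈ A, ∑ q ∈ B, dirCirc H (p.1, p.2.1.1, p.2.1.2) s * dirCirc H (q.1, q.2.1.1, q.2.1.2) s := fun s => by
    rw [Finset.sum_mul_sum]
  simp_rw [hexp]
  rw [integral_finsetSum _ fun p _ => integrable_finsetSum _ fun q _ => integrable_dirCirc_mul_dirCirc _ _]
  refine Finset.sum_congr rfl fun p _ => ?_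
  rw [integral_finsetSum _ fun q _ => integrable_dirCirc_mul_dirCirc _ _]
  exact Finset.sum_congr rfl fun q _ => integral_dirCirc_mul_eq_kernel _ _

/-! ## Sizes: `|K| ≤ 1`, variances, even moments -/

/-- Every `ℤ⁴`-plaquette has Dirichlet variance `≤ 1` (those touching the cold box by `integral_dirCirc_sq_le_one_of_touching`, the
others have identically vanishing circulation). -/
theorem integral_dirCirc_sq_le_one_zd (p : ZdPlaquette 4) :
    ∫ s, dirCirc H (p.1, p.2.1.1, p.2.1.2) s ^ 2 ∂(boxDirichlet H) ≤ 1 := by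
  by_cases hp : p ∈ plaquettesTouching (boxEdges 4 (2 * H + 1))
  · exact integral_dirCirc_sq_le_one_of_touching hp
  · have h0 : ∀ s : EuclideanSpace ℝ (DirFree H), dirCirc H (p.1, p.2.1.1, p.2.1.2) s = 0 := fun s =>
      sCirc_dirGlue_eq_zero_of_not_touching _ hp
    simp_rw [h0]
    simp

/-- **The Dirichlet projection kernel is bounded by one** on `ℤ⁴`-plaquettes: `|boxDirProjKernel H p q| ≤ 1`
(`2|s_ps_q| ≤ s_p² + s_q²` and both variances are `≤ 1`). -/
theorem abs_boxDirProjKernel_le_one (p q : ZdPlaquette 4) :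
    |boxDirProjKernel H (p.1, p.2.1.1, p.2.1.2) (q.1, q.2.1.1, q.2.1.2)| ≤ 1 := by
  rw [← integral_dirCirc_mul_eq_kernel]
  have hp := integral_dirCirc_sq_le_one_zd (H := H) p
  have hq := integral_dirCirc_sq_le_one_zd (H := H) q
  have hip := (integral_dirCirc_pow_even_le _ hp 1).1
  have hiq := (integral_dirCirc_pow_even_le _ hq 1).1
  simp only [mul_one] at hip hiq
  refine (abs_integral_le_integral_abs).trans ?_
  have hdom : ∀ s : EuclideanSpace ℝ (DirFree H),
      |dirCirc H (p.1, p.2.1.1, p.2.1.2) s * dirCirc H (q.1, q.2.1.1, q.2.1.2) s| ≤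
        (dirCirc H (p.1, p.2.1.1, p.2.1.2) s ^ 2 + dirCirc H (q.1, q.2.1.1, q.2.1.2) s ^ 2) / 2 := fun s => by
    rw [abs_mul]
    nlinarith [sq_nonneg (|dirCirc H (p.1, p.2.1.1, p.2.1.2) s| - |dirCirc H (q.1, q.2.1.1, q.2.1.2) s|),
      sq_abs (dirCirc H (p.1, p.2.1.1, p.2.1.2) s), sq_abs (dirCirc H (q.1, q.2.1.1, q.2.1.2) s)]
  calc ∫ s, |dirCirc H (p.1, p.2.1.1, p.2.1.2) s * dirCirc H (q.1, q.2.1.1, q.2.1.2) s| ∂(boxDirichlet H)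
      ≤ ∫ s, (dirCirc H (p.1, p.2.1.1, p.2.1.2) s ^ 2 + dirCirc H (q.1, q.2.1.1, q.2.1.2) s ^ 2) / 2 ∂(boxDirichlet H) :=
        integral_mono ((integrable_dirCirc_mul_dirCirc _ _).abs) ((hip.add hiq).div_const 2) hdom
    _ = ((∫ s, dirCirc H (p.1, p.2.1.1, p.2.1.2) s ^ 2 ∂(boxDirichlet H)) +
          ∫ s, dirCirc H (q.1, q.2.1.1, q.2.1.2) s ^ 2 ∂(boxDirichlet H)) / 2 := by
        rw [integral_div, integral_add hip hiq]
    _ ≤ (1 + 1) / 2 := by gcongr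
    _ = 1 := by norm_num

/-- **Variance of a surface sum**: `E_D[X_A²] ≤ (#A)²`. -/
theorem integral_surfSum_sq_le (A : Finset (ZdPlaquette 4)) :
    ∫ s, (∑ p ∈ A, dirCirc H (p.1, p.2.1.1, p.2.1.2) s) ^ 2 ∂(boxDirichlet H) ≤ ((#A : ℝ)) ^ 2 := by
  simp_rw [sq]
  rw [integral_surfSum_mul_surfSum]
  calc ∑ p ∈ A, ∑ q ∈ A, boxDirProjKernel H (p.1, p.2.1.1, p.2.1.2) (q.1, q.2.1.1, q.2.1.2)
      ≤ ∑ p ∈ A, ∑ q ∈ A, (1 : ℝ) := Finset.sum_le_sum fun p _ => Finset.sum_le_sum fun q _ =>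
        (le_abs_self _).trans (abs_boxDirProjKernel_le_one p q)
    _ = (#A : ℝ) * #A := by simp [mul_comm]

/-- The variance of a surface sum is nonnegative. -/
theorem integral_surfSum_sq_nonneg (A : Finset (ZdPlaquette 4)) :
    0 ≤ ∫ s, (∑ p ∈ A, dirCirc H (p.1, p.2.1.1, p.2.1.2) s) ^ 2 ∂(boxDirichlet H) :=
  integral_nonneg fun _ => sq_nonneg _

/-- **Even moments of a surface sum**: `X_A^{2r}` is integrable and `E_D[X_A^{2r}] ≤ ((#A)²)^r · (2r−1)!!` (Gaussian moments,
Janson Rem. 1.30, with the variance bound `integral_surfSum_sq_le`). -/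
theorem integral_surfSum_pow_even_le (A : Finset (ZdPlaquette 4)) (r : ℕ) :
    Integrable (fun s : EuclideanSpace ℝ (DirFree H) => (∑ p ∈ A, dirCirc H (p.1, p.2.1.1, p.2.1.2) s) ^ (2 * r)) (boxDirichlet H) ∧
      ∫ s, (∑ p ∈ A, dirCirc H (p.1, p.2.1.1, p.2.1.2) s) ^ (2 * r) ∂(boxDirichlet H) ≤
        (((#A : ℝ)) ^ 2) ^ r * ((2 * r - 1 : ℕ)‼ : ℝ) := by
  have hint : Integrable (fun s : EuclideanSpace ℝ (DirFree H) =>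
      (∑ p ∈ A, dirCirc H (p.1, p.2.1.1, p.2.1.2) s) ^ (2 * r)) (boxDirichlet H) := by
    have h := Literature.Probability.Distributions.GaussianWick.integrable_pow_mul_prod (isGaussianProcess_surfSum H) A (2 * r) (∅ : Finset (Fin 1)) (fun _ => A)
    simpa using h
  refine ⟨hint, ?_⟩
  rw [Literature.Probability.Distributions.GaussianWick.integral_pow_even_eq (isGaussianProcess_surfSum H) integral_surfSum A r, mul_comm]
  exact mul_le_mul_of_nonneg_right (pow_le_pow_left₀ (integral_surfSum_sq_nonneg A) (integral_surfSum_sq_le A) r)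
    (Nat.cast_nonneg _)

/-! ## Wick for squares of surface sums -/

/-- **Wick / Isserlis for squared surface sums**: `E_D[X_A²X_B²] − E_D[X_A²]·E_D[X_B²] = 2·E_D[X_AX_B]²` — the loop analogue of
`integral_dirCirc_sq_mul_sq_sub` (Janson Thm 1.28 with `n = 4`). -/
theorem integral_surfSum_sq_mul_sq_sub (A B : Finset (ZdPlaquette 4)) :
    (∫ s, (∑ p ∈ A, dirCirc H (p.1, p.2.1.1, p.2.1.2) s) ^ 2 * (∑ q ∈ B, dirCirc H (q.1, q.2.1.1, q.2.1.2) s) ^ 2 ∂(boxDirichlet H)) -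
        (∫ s, (∑ p ∈ A, dirCirc H (p.1, p.2.1.1, p.2.1.2) s) ^ 2 ∂(boxDirichlet H)) *
          (∫ s, (∑ q ∈ B, dirCirc H (q.1, q.2.1.1, q.2.1.2) s) ^ 2 ∂(boxDirichlet H)) =
      2 * (∫ s, (∑ p ∈ A, dirCirc H (p.1, p.2.1.1, p.2.1.2) s) * (∑ q ∈ B, dirCirc H (q.1, q.2.1.1, q.2.1.2) s)
        ∂(boxDirichlet H)) ^ 2 := by
  set X : Finset (ZdPlaquette 4) → EuclideanSpace ℝ (DirFree H) → ℝ :=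
    fun A s => ∑ p ∈ A, dirCirc H (p.1, p.2.1.1, p.2.1.2) s with hX
  have h4 := Literature.Probability.Distributions.GaussianWick.integral_prod_four (isGaussianProcess_surfSum H) integral_surfSum ![A, A, B, B]
  simp only [Matrix.cons_val_zero, Matrix.cons_val_one] at h4
  have e2 : (![A, A, B, B] : Fin 4 → Finset (ZdPlaquette 4)) 2 = B := rfl
  have e3 : (![A, A, B, B] : Fin 4 → Finset (ZdPlaquette 4)) 3 = B := rfl
  rw [e2, e3] at h4
  change (∫ s, X A s ^ 2 * X B s ^ 2 ∂(boxDirichlet H)) - (∫ s, X A s ^ 2 ∂(boxDirichlet H)) * (∫ s, X B s ^ 2 ∂(boxDirichlet H)) =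
    2 * (∫ s, X A s * X B s ∂(boxDirichlet H)) ^ 2
  change ∫ s, X A s * X A s * X B s * X B s ∂(boxDirichlet H) = _ at h4
  have hl : ∀ s, X A s ^ 2 * X B s ^ 2 = X A s * X A s * X B s * X B s := fun s => by ring
  have hA2 : ∀ s, X A s ^ 2 = X A s * X A s := fun s => by ring
  have hB2 : ∀ s, X B s ^ 2 = X B s * X B s := fun s => by ring
  simp_rw [hl, hA2, hB2, h4]
  ring

/-! ## Square integrability of the quadratic surrogate of one surface -/

/-- `X_A² ` is square-integrable: `X_A⁴ ∈ L¹`, so `½·X_A² ∈ L²(boxDirichlet H)`. -/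
theorem memLp_two_half_surfSum_sq (A : Finset (ZdPlaquette 4)) :
    MemLp (fun s : EuclideanSpace ℝ (DirFree H) => 1 / 2 * (∑ p ∈ A, dirCirc H (p.1, p.2.1.1, p.2.1.2) s) ^ 2) 2 (boxDirichlet H) := by
  have hint4 := (integral_surfSum_pow_even_le (H := H) A 2).1
  have hmeas : Measurable fun s : EuclideanSpace ℝ (DirFree H) => 1 / 2 * (∑ p ∈ A, dirCirc H (p.1, p.2.1.1, p.2.1.2) s) ^ 2 :=
    measurable_const.mul ((measurable_surfSum A).pow_const 2)
  refine (memLp_two_iff_integrable_sq hmeas.aestronglyMeasurable).2 ?_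
  have he : ∀ s : EuclideanSpace ℝ (DirFree H), (1 / 2 * (∑ p ∈ A, dirCirc H (p.1, p.2.1.1, p.2.1.2) s) ^ 2) ^ 2 =
      1 / 4 * (∑ p ∈ A, dirCirc H (p.1, p.2.1.1, p.2.1.2) s) ^ (2 * 2) := fun s => by ring
  simp_rw [he]
  exact hint4.const_mul _

/-- `X_A²` is integrable. -/
theorem integrable_surfSum_sq (A : Finset (ZdPlaquette 4)) :
    Integrable (fun s : EuclideanSpace ℝ (DirFree H) => (∑ p ∈ A, dirCirc H (p.1, p.2.1.1, p.2.1.2) s) ^ 2) (boxDirichlet H) := by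
  have h := (integral_surfSum_pow_even_le (H := H) A 1).1
  simpa using h

end Summit.QuantumFields.YangMills.Theorems.SoftLoopLongLag

end
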